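import Summits.ResolutionOfSingularities.ResolutionOfSingularities.Theorems.MarkedTransferCampaignW46WWalkModel
import HarnessLib

/-!
# [OURS · L1 W4.6 rung (iii-2)] THE W-WALK: cleaning raises the order — coefficient bookkeeping of `stepT`

Cell `res-hironaka`, LADDER-RESOLUTION rung L (D-0089), slot W4.6 rung (iii); seat res-L1-s46-pv-5 (gen 6), plan
`HOME/L/res-L1-s46-pv-5/W-WALK-PLAN.md` §5 (F3). Host route MarkedTransfer, `--supports stmt-ResolutionOfSingularities-16155 --as helper`;
kind proof (def-free).

WHAT. `lowVanish_shearZ` (the shear `z ↦ z − γt` preserves `ord ≥ n`), `coeff_chartT_zp`/`coeff_chartT_yp` (the uncleaned transform of a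
residual of order `≥ p + 1` has no `z^p` and no `y^p`), and **`lowVanish_succ_stepT`**: if the uncleaned transform `chartT p l f` has order
`≥ p` and its degree-`p` part is `γ^p t^p`, then the cleaned transform `stepT p l γ f` has order `≥ p + 1` (invariant (P2) of the walk).

HONEST FRAMING. OURS; nothing here is a statement of H. Hironaka's manuscript [Hironaka2017] and nothing of it is used. AI-written;
AI review is weaker than expert review. No `sorry`; axioms standard. [folklore]; [Hauser2010] §G for cleaning.
-/

noncomputable section

set_option linter.dupNamespace false -- mandated namespace of this single-conjunct summit

open MvPowerSeries Finset

namespace Summit.ResolutionOfSingularities.ResolutionOfSingularities.Theorems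

namespace CampaignW46

namespace WWalk

variable {K : Type*} [CommRing K]

/-- The shear `z ↦ z − γt` preserves `ord ≥ n` (it is homogeneous of degree `0`). [folklore] -/
theorem lowVanish_shearZ {n : ℕ} {γ : K} {h : MvPowerSeries (Option (Fin 2)) K} (hh : LowVanish n h) : LowVanish n (shearZ γ h) := by
  intro e he
  rw [← mk3_eta e, coeff_shearZ]
  refine sum_eq_zero fun i hi => ?_
  rw [mem_range] at hi
  rw [hh _ (by rw [degree_mk3]; rw [degree_eq] at he; omega), mul_zero]

/-- The uncleaned transform of a residual of order `≥ p + 1` has no monomial with `t`-exponent `0`; in particular no `z^p` and no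
`y^p`. [folklore] -/
theorem coeff_chartT_texp_zero {p : ℕ} {l : K} {f : MvPowerSeries (Option (Fin 2)) K} (hf : LowVanish (p + 1) f) (i c : ℕ) :
    coeff (mk3 0 i c) (chartT p l f) = 0 :=
  coeff_chartT_eq_zero_of_lt hf (by omega)

/-- **CLEANING RAISES THE ORDER.** If `chartT p l f` has order `≥ p` and all its degree-`p` coefficients vanish except possibly that of
`t^p`, which is `γ^p`, then `stepT p l γ f` has order `≥ p + 1`. [cite: Hauser2010, §G] -/
theorem lowVanish_succ_stepT {p : ℕ} {l γ : K} {f : MvPowerSeries (Option (Fin 2)) K} (hlow : LowVanish p (chartT p l f))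
    (hdeg : ∀ a b c, a + b + c = p → a ≠ p → coeff (mk3 a b c) (chartT p l f) = 0)
    (htp : coeff (mk3 p 0 0) (chartT p l f) = γ ^ p) : LowVanish (p + 1) (stepT p l γ f) := by
  rw [stepT]
  refine lowVanish_shearZ fun e he => ?_
  rw [← mk3_eta e, map_sub, coeff_C_mul_X_pow]
  rw [degree_eq] at he
  by_cases hp : e (some 0) + e (some 1) + e none = p
  · by_cases ha : e (some 0) = p
    · have hb : e (some 1) = 0 := by omega
      have hc : e none = 0 := by omega
      rw [ha, hb, hc, htp, if_pos ⟨rfl, rfl, rfl⟩, sub_self]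
    · rw [hdeg _ _ _ hp ha, if_neg (fun h => ha h.1), sub_zero]
  · rw [hlow _ (by rw [degree_mk3]; omega), if_neg (fun h => hp (by rw [h.1, h.2.1, h.2.2, add_zero, add_zero])), sub_zero]

end WWalk

end CampaignW46

end Summit.ResolutionOfSingularities.ResolutionOfSingularities.Theorems

end
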